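import Literature.MathematicalPhysics.QuantumLattice.DWaveSourceNNNHoppingFlatTwistEnergyDensity
import HarnessLib

/-!
# The flat-twisted pair-sourced `t–t'` torus: the twisted response density and the FULDE–FERRELL /
# PAIR-DENSITY-WAVE order parameter `m⋆_κ` as the Koma–Tasaki cusp of `e_src^tw(·;κ)` (definitions)

Topic `Literature/MathematicalPhysics/QuantumLattice` (namespace = path; family `hubbard`). Companion of
`DWaveSourceNNNHoppingFlatTwist.lean` (`dWaveSourceTorusTT'Twist L t' U μ h n`, the `t–t'–U` torus with the flat twist
`χ_L(n·e)` on every hop and the untwisted `d`-wave source; by the pure-gauge identity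
`conj_dWaveSourceTorusTT'Twist` it is the untwisted torus in the SPIRAL (Fulde–Ferrell) pair source `Δ_d^{(2n)}` of
pair momentum `2n`, `conj_pairField_eq_spiralPairField`), of `DWaveSourceNNNHoppingFlatTwistEnergyDensity.lean`
(`e^tw(t',U,μ,h;κ) = dWaveSourceEnergyDensityTT'Twist t' U μ h κ`) and of the untwisted dictionary
`PinningFieldPairingOrder.lean` / `DWaveSourceNNNHoppingOrderParameter.lean` (`dWaveSourceDensityTT'`,
`dWaveOrderParameterTT' t' U μ = m⋆`, whose cusp identity `m⋆ = ⨅_{h>0} (e_src(0) − e_src(h))/(2h)` is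
`dWaveOrderParameterTT'_eq_iInf_slope_energyDensity`). This file only NAMES two objects; the theorems (Hellmann–Feynman
sandwich on the twisted torus, concavity / Lipschitz continuity of `e^tw(·;κ)`, Griffiths brackets, the cusp identity
along every trivial-holonomy ladder, `m⋆_1 = m⋆`, and the small-field slope of the helicity chord density
`σ(h;κ)/(2h) → m⋆ − m⋆_κ`) are in `DWaveSourceNNNHoppingFlatTwistCusp.lean`.

* `dWaveSourceDensityTT'Twist L t' U μ h n = Re ω₀^{tw}(Δ_d)/L²` — the `d`-wave pair amplitude per site of the
  tracial ground state of the TWISTED sourced torus (tree units, exactly as `dWaveSourceDensityTT'`); in the gauge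
  picture it is the SPIRAL pair amplitude `Re ω₀(Δ_d^{(2n)})/L²` of the untwisted torus in the spiral source (that
  density-level reading of `conj_dWaveSourceTorusTT'Twist` is NOT typed here; only the energies are used).
* `dWaveOrderParameterTT'Twist t' U μ κ = ⨅_{h>0} (e^tw(t',U,μ,0;κ) − e^tw(t',U,μ,h;κ))/(2h)` — the Koma–Tasaki CUSP of
  the twisted energy density at zero source: the quasi-average FULDE–FERRELL / PAIR-DENSITY-WAVE order parameter
  `m⋆_κ` at pair momentum `q = 2·arg κ` per bond (the companion file proves it is `lim_{h→0⁺}` of the secant,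
  `= ⨅_{h>0} liminf_L` of the twisted response densities along every realising ladder, and `= m⋆` at `κ = 1`).

HONEST SCOPE: definitions; grand-canonical (`Matrix.groundEnergy` / tracial ground state) objects; hopping `t = 1`;
nothing here asserts that any order parameter is positive or zero; the PDW-versus-uniform question at `t' < 0` is a
sub-question of the cuprate question which this file only gives a typed order parameter.

## References
* T. Koma, H. Tasaki, J. Stat. Phys. 76 (1994) 745, §1 (order parameters as `h ↓ 0` after `Λ ↑ ℤ^d` of sourced
  ground states; concavity in `h`). [cite: KomaTasaki1994, §1]
* P. Fulde, R. A. Ferrell, Phys. Rev. 135 (1964) A550, §II (pairing at finite centre-of-mass momentum).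
  [cite: FuldeFerrell1964, §II]
* R. B. Griffiths, Phys. Rev. 152 (1966) 240, §II (one-sided derivatives bound the conjugate order parameter).
  [cite: Griffiths1966, §II]
* H. Watanabe, J. Stat. Phys. 177 (2019) 717, §2.2.1 (flat twists). [cite: Watanabe2019, §2.2.1]
-/

noncomputable section

namespace Literature.MathematicalPhysics.QuantumLattice

open _root_.Matrix Finset HubbardWave0 Literature.Probability.LatticeModels

/-- **The twisted sourced `d`-wave pair density** (tree units): `Re ω₀(Δ_d)/L²` in the tracial ground state `ω₀` of
`dWaveSourceTorusTT'Twist L t' U μ h n` (in the gauge picture of `conj_dWaveSourceTorusTT'Twist`: the SPIRAL pair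
amplitude of the untwisted `t–t'` torus in the Fulde–Ferrell pair source of pair momentum `2n`; that reading is not
typed here). [cite: KomaTasaki1994, §1] -/
def dWaveSourceDensityTT'Twist (L : ℕ) [NeZero L] (t' U μ h : ℝ) (n : Fin 2 → ZMod L) : ℝ :=
  ((dWaveSourceTorusTT'Twist L t' U μ h n).groundStateFunctional (pairField dWaveFormFactor L)).re / (L : ℝ) ^ 2

/-- **The Fulde–Ferrell / pair-density-wave order parameter at bond phase `κ`**:
`m⋆_κ(t',U,μ) = ⨅_{h>0} (e^tw(t',U,μ,0;κ) − e^tw(t',U,μ,h;κ))/(2h)`, the Koma–Tasaki cusp of the flat-twisted sourced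
energy density at zero source (at `κ = 1`: the tree's `dWaveOrderParameterTT' t' U μ`, by its cusp identity).
[cite: KomaTasaki1994, §1] -/
def dWaveOrderParameterTT'Twist (t' U μ : ℝ) (κ : Fin 2 → Circle) : ℝ :=
  ⨅ h : Set.Ioi (0 : ℝ),
    (dWaveSourceEnergyDensityTT'Twist t' U μ 0 κ - dWaveSourceEnergyDensityTT'Twist t' U μ h κ) / (2 * (h : ℝ))

end Literature.MathematicalPhysics.QuantumLattice

end
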